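import Summits.QuantumFields.BalabanUV.T4Continuum.Support.NE7RadIterUniform
import Summits.QuantumFields.BalabanUV.T4Continuum.Support.MinimalActionRate
import HarnessLib

/-!
# NE7ClassMinimiserLoops — A CONFIGURATION OF THE SMALL-FIELD CLASS `sfClass d L N ε (j+1)` HAS LOOP VARIABLES WITHIN `1/4` OF `1` AT EVERY LEVEL OF THE TOWER, UNIFORMLY IN `j`:
# `‖W_{c,x}[cavgIter L m U] − 1‖ ≤ 1/4` for all `m ≤ j` (every `d`, every `U(n)`, `L ≥ 2`, `ε ≤ ε₁(d, L)`)

Lineage `b2b-balaban-t4-ne7-p1` (CRUX PROVER NE7 #1 = OWNER of BINDER row NE7), generation 116 — brick 6b of ROAD-G116 §8: the binder of ✓ `NE7AbelianEffectiveFormCurved` («the minimiser's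
iterated averages have small loops») DISCHARGED from class membership alone, for GENERAL `n`.  Ingredients: ✓ `NE7RadIterUniform.levelSmall_of_class_radius` (the radii along the tower stay
`≤ 2ε·L^{−2(j+1−m)}`, and `LevelSmall` holds), ✓ `AveragingDeficitMultiLevelPrep.cavgIter_unitary_small` (B7 Prop. 1 through the tower) and ✓ `MinimalActionLevels.norm_Wcx_sub_one_le_quarter`.
WHAT ([folklore]; 0 def, 0 sorry): **`loops_small_of_sfClass`** — thresholds `4ε·radD·L^{−4} ≤ 1`, `twoLevelSmall·2ε·L^{−2} ≤ 1`, `1024(d+1)(d+4)·ε ≤ 1`.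
HONEST FRAMING: bookkeeping of OUR class radii; nothing of Bałaban's asserted; NOT NE7 as a spine node; spine 0∕9; NOT infinite volume, NOT mass gap, NOT BetaPertH, NOT Clay.
-/

set_option autoImplicit false

open scoped BigOperators Matrix Matrix.Norms.L2Operator
open Finset

namespace Summit.QuantumFields.BalabanUV.T4Continuum.NE7ClassMinimiserLoops

open Literature.MathematicalPhysics.QuantumFieldTheory.Balaban1983to89
open B7Prop1Explicit B7Prop2Explicit
open T4AveragingDeficitWall (IsUnitaryCfg SmallField)
open AveragingDeficitTwoLevelPrep (prop1Radius twoLevelSmall)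
open AveragingDeficitMultiLevelPrep (radIter LevelSmall cavgIter cavgIter_unitary_small)
open MinimalActionLevels (norm_Wcx_sub_one_le_quarter)
open MinimalActionRate (sfClass)
open NE7RadIterUniform (radD levelSmall_of_class_radius levelSmall_of_radIter_le radIter_nonneg)

noncomputable section

variable {d : ℕ} {n : Type} [Fintype n] [DecidableEq n]

/-- **LOOPS ARE SMALL AT EVERY LEVEL FOR A CLASS CONFIGURATION** (`L ≥ 2`, `0 ≤ ε` below the three explicit thresholds): for `U ∈ sfClass d L N ε (j+1)` and every `m ≤ j`,
`‖W_{c,x}[cavgIter L m U] − 1‖ ≤ 1/4` for all coarse bonds `c` and block points `x`. [folklore] -/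
theorem loops_small_of_sfClass [Nonempty n] {L : ℕ} (hL : 2 ≤ L) {N : ℕ} {ε : ℝ} (hε : 0 ≤ ε)
    (hεD : 4 * ε * radD d L * (((L : ℝ) ^ 2)⁻¹) ^ 2 ≤ 1) (hεT : twoLevelSmall d L * (2 * ε * ((L : ℝ) ^ 2)⁻¹) ≤ 1)
    (hε1024 : 1024 * ((d : ℝ) + 1) * ((d : ℝ) + 4) * ε ≤ 1) (j : ℕ) {U : Site d → Fin d → (Matrix n n ℂ)ˣ} (hU : U ∈ sfClass d L N ε (j + 1)) :
    ∀ m ≤ j, ∀ (q : Site d) (κ : Fin d) (r : Fin d → Fin L), ‖((Wcx L (cavgIter L m U) q κ (boxVec L r) : (Matrix n n ℂ)ˣ) : Matrix n n ℂ) - 1‖ ≤ 1 / 4 := by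
  have hL1 : 1 ≤ L := by omega
  obtain ⟨hUu, -, hUsf⟩ := hU
  set q : ℝ := ((L : ℝ) ^ 2)⁻¹ with hq
  have hL2 : (0 : ℝ) < (L : ℝ) ^ 2 := by positivity
  have hq0 : 0 ≤ q := by positivity
  have hq1 : q ≤ 1 := by rw [hq]; exact inv_le_one_of_one_le₀ (one_le_pow₀ (by exact_mod_cast hL1))
  have hLq : (L : ℝ) ^ 2 * q = 1 := by rw [hq, mul_inv_cancel₀ hL2.ne']
  -- the class radius is `ε·q^{j+1}`
  have hx0eq : ε / ((L : ℝ) ^ (j + 1)) ^ 2 = ε * q ^ (j + 1) := by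
    rw [hq, inv_pow, ← pow_mul, div_eq_mul_inv, ← pow_mul, mul_comm (j + 1) 2]
  have hx0 : 0 ≤ ε * q ^ (j + 1) := by positivity
  have hUsf' : SmallField U (ε * q ^ (j + 1)) := by rw [← hx0eq]; exact hUsf
  obtain ⟨-, hrad⟩ := levelSmall_of_class_radius (d := d) hL hε hεD hεT j
  -- the radius at level `m ≤ j` and the `1/4`-threshold
  have hsmall : ∀ m ≤ j, 512 * ((d : ℝ) + 1) * ((d : ℝ) + 4) * (L : ℝ) ^ 2 * radIter d L m (ε * q ^ (j + 1)) ≤ 1 := by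
    intro m hm
    have h1 := hrad m (by omega)
    have h2 : q ^ (j + 1 - m) ≤ q := by
      calc q ^ (j + 1 - m) ≤ q ^ 1 := pow_le_pow_of_le_one hq0 hq1 (by omega)
        _ = q := pow_one q
    have h3 : radIter d L m (ε * q ^ (j + 1)) ≤ 2 * ε * q := h1.trans (by nlinarith)
    calc 512 * ((d : ℝ) + 1) * ((d : ℝ) + 4) * (L : ℝ) ^ 2 * radIter d L m (ε * q ^ (j + 1))
        ≤ 512 * ((d : ℝ) + 1) * ((d : ℝ) + 4) * (L : ℝ) ^ 2 * (2 * ε * q) := by gcongr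
      _ = 1024 * ((d : ℝ) + 1) * ((d : ℝ) + 4) * ε * ((L : ℝ) ^ 2 * q) := by ring
      _ ≤ 1 := by rw [hLq, mul_one]; exact hε1024
  intro m hm qq κ r
  rcases m with _ | i
  · exact norm_Wcx_sub_one_le_quarter L hL1 hUu hx0 (by simpa [radIter] using hsmall 0 hm) hUsf' qq κ r
  · have hLS : LevelSmall d L i (ε * q ^ (j + 1)) := levelSmall_of_radIter_le i fun i' hi' => by
      have hT : 0 ≤ twoLevelSmall d L := by unfold twoLevelSmall; positivity
      have h1 := hrad i' (by omega)
      have h2 : q ^ (j + 1 - i') ≤ q := by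
        calc q ^ (j + 1 - i') ≤ q ^ 1 := pow_le_pow_of_le_one hq0 hq1 (by omega)
          _ = q := pow_one q
      calc twoLevelSmall d L * radIter d L i' (ε * q ^ (j + 1)) ≤ twoLevelSmall d L * (2 * ε * q) := by
            refine mul_le_mul_of_nonneg_left (h1.trans ?_) hT
            nlinarith
        _ ≤ 1 := hεT
    obtain ⟨hu, hr0, hsf⟩ := cavgIter_unitary_small (d := d) hL1 i hUu hx0 hLS hUsf'
    exact norm_Wcx_sub_one_le_quarter L hL1 hu hr0 (hsmall (i + 1) hm) hsf qq κ r

end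

end Summit.QuantumFields.BalabanUV.T4Continuum.NE7ClassMinimiserLoops
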